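import Summits.BirchSwinnertonDyer.BirchSwinnertonDyer.Theorems.SignedLowerHalvesKobayashiLowerHalfLargeImageLambdaTwoStratumOddPrime
import Summits.BirchSwinnertonDyer.BirchSwinnertonDyer.Theorems.SignedLowerHalvesKobayashiMainConjectureSmallImageKatoIntegralOfMu
import HarnessLib

/-!
# Route `SignedLowerHalves` (K3), crux 4 `KobayashiMainConjectureSmallImage` (item stmt-BirchSwinnertonDyer-19002):
# the `λ = 2` STRATUM AT SMALL IMAGE — slh-p1's `λ = 2` squeezes with the surjectivity of `ρ̄_{E,p}` REPLACED by
# `μ^ε = 0` (Kato made integral by `μ`, `…SmallImageKatoIntegralOfMu`), so that they run at ANY image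

Cell `bsd-ssimc`, seat `bsd-line-slh-p3` LEAD gen 12 (helper file `--supports stmt-BirchSwinnertonDyer-19002`; CALIBRATION /
SUPPORT ONLY, route-independent). HONEST FRAMING: THEOREMS ONLY, CONDITIONAL on displayed published binders — Kobayashi 2003
Thm. 1.2 (`h12`), Thm. 4.1 (`h41`; ONLY its image-free rational display), the period units (`h5 h3`), B. D. Kim 2013
Cor. 3.15 (`hK13`), `p`-parity (`hpar`) — and displayed per-pair hypotheses: the certificate `(μ, λ)(L_p^ε) = (0, 2)`,
`μ^ε = 0` (the `μ`-invariant of every characteristic power series of every key-`γ` signed dual datum), and on the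
finite-Selmer branch the algebraic functional equation `ι(Char X^ε) = Char X^ε` at the pair (`hAFE`, Kim 2008
Thm. 3.12 for `p > 3`) plus ONE bit `p ∣ Tam(E)·#Sel_{p^∞}(E/ℚ)`. Nothing about any curve is asserted; BSD / crux 4
NOT proved. The proofs are those of seat `bsd-line-slh-p1` LEAD g12/g17 (`…LargeImageLambdaTwoStratum{,MainConjecture,
OddPrime}`) verbatim, with the single line «`ξ ∣ L_p^ε` by Thm. 4.1 under `p`-adic surjectivity» replaced by
«`ξ ∣ L_p^ε` by Thm. 4.1-rational and `μ(ξ) = 0`» (`SmallImageKatoIntegralOfMu.dvd_of_charIdeal_eq_span_of_mu_eq_zero`);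
Wuthrich's Lemma 20 (`hL20`) and `Surj W p` disappear.

## What is proved (odd good `p`, `a_p = 0`, `f₀` the newform of level `N_E`, certificate `(0, 2)` for the sign `ε`)

* `kobayashiMainConjecture_of_lam_eq_two_of_two_le_selmerCorank_of_mu` — `corank_{ℤ_p} Sel_{p^∞}(E/ℚ) ≥ 2` ⟹ MC(ε).
* `kobayashiMainConjecture_of_lam_eq_two_of_selmerCorank_ne_zero_of_mu` — corank `≠ 0` ⟹ MC(ε) (parity: the corank is even).
* `kobayashiMainConjecture_of_lam_eq_two_of_finite_of_dvd_of_afe_of_mu` — `Sel_{p^∞}` finite, `p ∣ Tam·#Sel`, `hAFE` ⟹ MC(ε).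
* `kobayashiMainConjecture_of_lam_eq_two_of_imp_of_afe_of_mu` — both branches: MC(ε) UNLESS `Sel_{p^∞}` is finite with
  `p ∤ Tam·#Sel`; `X7.kobayashiMainConjecture_of_lam_eq_two_of_imp_of_afe_of_mu` (crux 4's binder shape, `¬Surj` displayed).
READING for item 19002: with `…SmallImageParityStratumExact{,Crux}` (the `(0, ≤ 1)`-stratum) this pushes the small-image
boundary to: modulo print + `μ^ε = 0`, crux 4 is open only at pairs where every certified sign has `λ ≥ 3`, or `λ = 2` on
the cell «`Sel_{p^∞}(E/ℚ)` finite, `p ∤ Tam·#Sel`» (where MC(ε) predicts `λ(ξ^ε) = 0 ≠ 2`: that cell should be EMPTY —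
it is the `λ = 2` shadow census of the slh-p1 lineage), or at `p = 3` without `hAFE`.

References: [Kobayashi2003] Thm. 1.2, Thm. 4.1, Conjecture (p. 2); [KimBD2008MRL] Thm. 3.12; [BDKim2013] Cor. 3.15;
[DokchitserDokchitserAnnals2010] Thm. 1.4; [Sprung2017] Cor. 4.14; [GreenbergLNM1716] §1, §3 Lemma 3.1, §5;
[GreenbergVatsal2000] p. 4; [Washington1997] §13.1.
-/

set_option autoImplicit false
set_option linter.dupNamespace false

noncomputable section

open scoped Classical MatrixGroups ModularForm

open CongruenceSubgroup PowerSeries WeierstrassCurve Literature.NumberTheory.EllipticCurves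
  Literature.NumberTheory.EllipticCurves.ModularForms Literature.Barriers.BirchSwinnertonDyer
  Literature.NumberTheory.EllipticCurves.Rank1Residual Literature.NumberTheory.EllipticCurves.Sprung2017
  Literature.NumberTheory.EllipticCurves.Kobayashi2003 ZpExtension
  Literature.NumberTheory.EllipticCurves.Rank1Residual.Typed
  Summit.BirchSwinnertonDyer.Rank1Residual Summit.BirchSwinnertonDyer.Rank1Residual.X1.MuLambda
  Summit.BirchSwinnertonDyer.Rank1Residual.Supersingular
  Summit.BirchSwinnertonDyer.BirchSwinnertonDyer.Theorems.LargeImageParityStratum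
  Summit.BirchSwinnertonDyer.BirchSwinnertonDyer.Theorems.LargeImageLambdaTwoStratum
  Summit.BirchSwinnertonDyer.BirchSwinnertonDyer.Theorems.SmallImageKatoIntegralOfMu

namespace Summit.BirchSwinnertonDyer.BirchSwinnertonDyer.Theorems.SmallImageLambdaTwoStratum

variable (W : WeierstrassCurve ℚ) [W.IsElliptic] [W.IsGloballyMinimal] (p : ℕ) [Fact p.Prime]

/-! ## §1. Branch «corank»: `corank ≥ 2` (or `≠ 0` with parity), ANY image -/

/-- **MC(ε) at a `(0, 2)`-certified pair with `corank_{ℤ_p} Sel_{p^∞}(E/ℚ) ≥ 2`, ANY image, granted `μ^ε = 0`.**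
Odd good `p`, `a_p = 0`; BY NAME `h12`, `h41` (rational display), `h5`, `h3`; per pair the certificate and `hμX`. Squeeze:
`T^{corank} ∣ ξ^ε` (signed corank control), so `λ(ξ^ε) ≥ 2 = λ(L_p^ε)`; `ξ^ε ∣ L_p^ε` by Thm. 4.1-rational + `μ(ξ^ε) = 0`;
the cofactor is a unit. [cite: Kobayashi2003, Thm. 1.2 (p. 2), Thm. 4.1 (p. 8) and Conjecture (p. 2)]
[cite: GreenbergLNM1716, §1 p. 65 and §3 Lemma 3.1] [cite: GreenbergVatsal2000, p. 4] [cite: Washington1997, §13.1] -/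
theorem kobayashiMainConjecture_of_lam_eq_two_of_two_le_selmerCorank_of_mu
    (h12 : Kobayashi2003.thm12_signedSelmerDual_finite_torsion)
    (h41 : Kobayashi2003.thm41_signedCharIdeal_divisibility)
    (h5 : realPeriodRat_eq_unit_mul_plusPeriod) (h3 : realPeriodRat_eq_unit_mul_plusPeriod_three)
    (hp : p ≠ 2) (hgood : W.HasGoodReductionAtPrime p) (hap : W.frobeniusTrace p = 0) (ε : ℤˣ)
    [NeZero (W.conductorNorm ℤ)] {f₀ : CuspForm (Gamma0 (W.conductorNorm ℤ)) 2} (hf₀ : IsNewformOf W f₀)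
    (hcert₀ : ∀ L : IwasawaAlgebra p, IsSignedPAdicLFunction f₀ p ε L → mu L = 0 ∧ lam L = 2)
    (hμX : ∀ (κ : ZpExtension ℚ p) (γ : Field.absoluteGaloisGroup ℚ), κ.IsCyclotomic → κ.IsTopGenerator γ →
      IsCyclotomicVariable p γ → ∀ (D : SignedSelmerDualData W κ γ ε) (ξ : IwasawaAlgebra p),
        D.charIdeal = Ideal.span {ξ} → mu ξ = 0)
    (hcork : 2 ≤ W.selmerCorank p) :
    KobayashiMainConjecture W p ε := by
  intro κ γ hκ hγ hγ' _ f hf ϖ hϖ Lplus Lminus hPP D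
  have hff : f = f₀ := hf.unique hf₀
  subst hff
  haveI : Module.Finite (IwasawaAlgebra p) D.X := h12.moduleFinite hp hgood hap hκ hγ D
  have hX : Module.IsTorsion (IwasawaAlgebra p) D.X := h12.isTorsion hp hgood hap hκ hγ D
  refine ⟨hX, ?_⟩
  obtain ⟨ξ, hξ⟩ := (charIdeal_isPrincipal_holds p D.X).principal
  have hξ' : D.charIdeal = Ideal.span {ξ} := hξ
  set L := kobayashiL ε Lplus Lminus with hL_def
  have hL : IsSignedPAdicLFunction f p ε L := hPP.isSignedPAdicLFunction_kobayashiL ε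
  have hL0 : L ≠ 0 := kobayashiL_ne_zero p hPP ε
  -- (MC↑), made integral by `μ`: `ξ ∣ L`
  have hμξ : mu ξ = 0 := hμX κ γ hκ hγ hγ' D ξ hξ'
  have hU : ξ ∣ L := dvd_of_charIdeal_eq_span_of_mu_eq_zero h41 hp hgood hap hf hκ hγ hγ' hL hL0 D hX hξ' hμξ
  have hξ0 : ξ ≠ 0 := by
    obtain ⟨h, hh⟩ := hU
    exact fun h0 ↦ hL0 (by rw [hh, h0, zero_mul])
  -- the certificate, and `T² ∣ ξ` by the corank control
  obtain ⟨hμ, hlam⟩ := hcert₀ L hL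
  have hC : (X : IwasawaAlgebra p) ^ 2 ∣ ξ :=
    (pow_dvd_pow X hcork).trans (D.X_pow_selmerCorank_dvd_of_charIdeal_eq_span hγ hX hξ')
  have hlamξ : 2 ≤ lam ξ := X2.le_lam_of_X_pow_dvd hξ0 hC
  have hspan : Ideal.span ({ξ} : Set (IwasawaAlgebra p)) = Ideal.span {L} :=
    span_eq_span_of_dvd_of_lam_le hL0 hU hμ (by rw [hlam]; exact hlamξ)
  exact exists_generator_of_span_eq W p h5 h3 hp hgood hap hf hϖ hξ' hspan

/-- **The same with `corank_{ℤ_p} Sel_{p^∞}(E/ℚ) ≠ 0`**, granted in addition `p`-parity (`hpar`): on the `λ = 2` stratum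
the corank is even (`even_selmerCorank_of_lam_eq_two`, Sprung's functional equation a tree theorem), so `≠ 0` means
`≥ 2`. ANY image. [cite: Kobayashi2003, Thm. 1.2, Thm. 4.1 and Conjecture (p. 2)] [cite: DokchitserDokchitserAnnals2010, Thm. 1.4]
[cite: Sprung2017, Cor. 4.14 (a_p = 0 display)] -/
theorem kobayashiMainConjecture_of_lam_eq_two_of_selmerCorank_ne_zero_of_mu
    (h12 : Kobayashi2003.thm12_signedSelmerDual_finite_torsion)
    (h41 : Kobayashi2003.thm41_signedCharIdeal_divisibility)
    (h5 : realPeriodRat_eq_unit_mul_plusPeriod) (h3 : realPeriodRat_eq_unit_mul_plusPeriod_three)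
    (hpar : p_parity W p) (hp : p ≠ 2) (hgood : W.HasGoodReductionAtPrime p) (hap : W.frobeniusTrace p = 0) (ε : ℤˣ)
    [NeZero (W.conductorNorm ℤ)] {f₀ : CuspForm (Gamma0 (W.conductorNorm ℤ)) 2} (hf₀ : IsNewformOf W f₀)
    (hcert₀ : ∀ L : IwasawaAlgebra p, IsSignedPAdicLFunction f₀ p ε L → mu L = 0 ∧ lam L = 2)
    (hμX : ∀ (κ : ZpExtension ℚ p) (γ : Field.absoluteGaloisGroup ℚ), κ.IsCyclotomic → κ.IsTopGenerator γ →
      IsCyclotomicVariable p γ → ∀ (D : SignedSelmerDualData W κ γ ε) (ξ : IwasawaAlgebra p),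
        D.charIdeal = Ideal.span {ξ} → mu ξ = 0)
    (hcork : W.selmerCorank p ≠ 0) :
    KobayashiMainConjecture W p ε := by
  obtain ⟨Lplus, Lminus, hPP⟩ :=
    exists_isPollackPair pollack_exists_plusMinusPAdicLFunction_holds hp hf₀ hgood hap
  obtain ⟨hμ, hlam⟩ := hcert₀ _ (hPP.isSignedPAdicLFunction_kobayashiL ε)
  have hev := even_selmerCorank_of_lam_eq_two W p hpar cor414_sharpFlat_functionalEquation_apZero_holds hp hgood
    hap hf₀ hPP ε hμ hlam
  have h2 : 2 ≤ W.selmerCorank p := by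
    obtain ⟨k, hk⟩ := hev
    omega
  exact kobayashiMainConjecture_of_lam_eq_two_of_two_le_selmerCorank_of_mu W p h12 h41 h5 h3 hp hgood hap ε hf₀
    hcert₀ hμX h2

/-! ## §2. Branch «finite Selmer»: `Sel_{p^∞}(E/ℚ)` finite, `p ∣ Tam · #Sel`, granted the algebraic FE at the pair -/

/-- **MC(ε) at a `(0, 2)`-certified pair with `Sel_{p^∞}(E/ℚ)` FINITE and `p ∣ ∏ c_ℓ · #Sel_{p^∞}(E/ℚ)`, ANY image,
granted `μ^ε = 0` and the algebraic functional equation at the pair** (`hAFE`: `ι(Char X^ε) = Char X^ε`, Kim 2008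
Thm. 3.12 for `p > 3`). BY NAME `h12 h41 h5 h3 hK13`. Proof (slh-p1's): `ξ ∣ L_p^ε` (here by `μ(ξ) = 0`) gives
`λ(ξ) ≤ 2`; `λ(ξ) = 0` would make `ξ` a unit but `p ∣ ξ(0)` (`hK13` + the divisibility bit); `λ(ξ) = 1` would give
`ξ(0) = 0` by the two-coefficient engine applied to `ι ξ = v ξ`, but `ξ(0) ≠ 0` (`hK13`); so `λ(ξ) = 2`, `(ξ) = (L_p^ε)`.
[cite: Kobayashi2003, Thm. 1.2 (p. 2), Thm. 4.1 (p. 8) and Conjecture (p. 2)] [cite: KimBD2008MRL, Thm. 3.12 (p. 93)]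
[cite: BDKim2013, Cor. 3.15 (p. 199)] [cite: GreenbergVatsal2000, p. 4] [cite: Washington1997, §13.1] -/
theorem kobayashiMainConjecture_of_lam_eq_two_of_finite_of_dvd_of_afe_of_mu
    (h12 : Kobayashi2003.thm12_signedSelmerDual_finite_torsion)
    (h41 : Kobayashi2003.thm41_signedCharIdeal_divisibility)
    (h5 : realPeriodRat_eq_unit_mul_plusPeriod) (h3 : realPeriodRat_eq_unit_mul_plusPeriod_three)
    (hK13 : BDKim2013.cor315_signedCharValue_rankZero)
    (hp : p ≠ 2) (hgood : W.HasGoodReductionAtPrime p) (hap : W.frobeniusTrace p = 0) (ε : ℤˣ)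
    (hAFE : ∀ (κ : ZpExtension ℚ p) (γ : Field.absoluteGaloisGroup ℚ), κ.IsCyclotomic →
      κ.IsTopGenerator γ → ∀ D : SignedSelmerDualData W κ γ ε,
        Ideal.map (IwasawaAlgebra.invol p) D.charIdeal = D.charIdeal)
    [NeZero (W.conductorNorm ℤ)] {f₀ : CuspForm (Gamma0 (W.conductorNorm ℤ)) 2} (hf₀ : IsNewformOf W f₀)
    (hcert₀ : ∀ L : IwasawaAlgebra p, IsSignedPAdicLFunction f₀ p ε L → mu L = 0 ∧ lam L = 2)
    (hμX : ∀ (κ : ZpExtension ℚ p) (γ : Field.absoluteGaloisGroup ℚ), κ.IsCyclotomic → κ.IsTopGenerator γ →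
      IsCyclotomicVariable p γ → ∀ (D : SignedSelmerDualData W κ γ ε) (ξ : IwasawaAlgebra p),
        D.charIdeal = Ideal.span {ξ} → mu ξ = 0)
    (hfin : Finite (W.selmerGroupPInfty p))
    (hdvd : p ∣ W.tamagawaProduct * Nat.card (W.selmerGroupPInfty p)) :
    KobayashiMainConjecture W p ε := by
  have hpP : p.Prime := Fact.out
  intro κ γ hκ hγ hγ' _ f hf ϖ hϖ Lplus Lminus hPP D
  have hff : f = f₀ := hf.unique hf₀
  subst hff
  haveI : Module.Finite (IwasawaAlgebra p) D.X := h12.moduleFinite hp hgood hap hκ hγ D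
  have hX : Module.IsTorsion (IwasawaAlgebra p) D.X := h12.isTorsion hp hgood hap hκ hγ D
  refine ⟨hX, ?_⟩
  obtain ⟨ξ, hξ⟩ := (charIdeal_isPrincipal_holds p D.X).principal
  have hξ' : D.charIdeal = Ideal.span {ξ} := hξ
  set L := kobayashiL ε Lplus Lminus with hL_def
  have hL : IsSignedPAdicLFunction f p ε L := hPP.isSignedPAdicLFunction_kobayashiL ε
  have hL0 : L ≠ 0 := kobayashiL_ne_zero p hPP ε
  -- (MC↑), made integral by `μ`
  have hμξ : mu ξ = 0 := hμX κ γ hκ hγ hγ' D ξ hξ'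
  have hU : ξ ∣ L := dvd_of_charIdeal_eq_span_of_mu_eq_zero h41 hp hgood hap hf hκ hγ hγ' hL hL0 D hX hξ' hμξ
  obtain ⟨hμ, hlam⟩ := hcert₀ L hL
  obtain ⟨h, hh⟩ := hU
  have hξ0 : ξ ≠ 0 := fun h0 ↦ hL0 (by rw [hh, h0, zero_mul])
  -- `ξ(0) ≠ 0` and `p ∣ ξ(0)` (Kim 2013 Cor. 3.15 + the divisibility bit)
  have hc0ne : constantCoeff ξ ≠ 0 :=
    BDKim2013.cor315_signedCharValue_rankZero.constantCoeff_ne_zero hK13 hp hgood hap hκ hγ D hX hξ' hfin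
  have hc0dvd : (p : ℤ_[p]) ∣ constantCoeff ξ := by
    obtain ⟨u, hu⟩ := hK13 W p hp hgood hap κ γ hκ hγ ε D hX ξ hξ' hfin
    have hu' : constantCoeff ξ = (u : ℤ_[p]) * (p : ℤ_[p]) ^ padicValNat p W.tamagawaProduct *
        (Nat.card (W.selmerGroupPInfty p) : ℤ_[p]) := by
      refine PadicInt.ext ?_
      push_cast
      exact hu
    rw [hu']
    rcases hpP.dvd_mul.mp hdvd with ht | hc
    · have ht1 : 1 ≤ padicValNat p W.tamagawaProduct :=
        one_le_padicValNat_of_dvd (W.tamagawaProduct_pos').ne' ht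
      exact Dvd.dvd.mul_right (Dvd.dvd.mul_left (dvd_pow_self _ (by omega)) _) _
    · exact Dvd.dvd.mul_left (Nat.cast_dvd_cast hc) _
  -- the algebraic functional equation AT THE PAIR, generator form: `ι ξ = v ξ` with `v ∈ Λˣ`
  have hgen : ∃ v : (IwasawaAlgebra p)ˣ, IwasawaAlgebra.invol p ξ = (v : IwasawaAlgebra p) * ξ := by
    have hmap := hAFE κ γ hκ hγ D
    rw [hξ', Ideal.map_span, Set.image_singleton] at hmap
    obtain ⟨v, hv⟩ := Ideal.span_singleton_eq_span_singleton.mp hmap.symm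
    exact ⟨v, by rw [← hv, mul_comm]⟩
  -- `λ(ξ) ≥ 2`
  have hlamξ : 2 ≤ lam ξ := by
    by_contra hlt
    rcases Nat.le_one_iff_eq_zero_or_eq_one.mp (Nat.lt_succ_iff.mp (not_le.mp hlt)) with hl | hl
    · have hunit : IsUnit ξ := (isUnit_iff_mu_eq_zero_and_lam_eq_zero ξ).mpr ⟨hξ0, hμξ, hl⟩
      exact not_isUnit_of_dvd hc0dvd (PowerSeries.isUnit_iff_constantCoeff.mp hunit)
    · obtain ⟨v, hv⟩ := hgen
      rw [IwasawaAlgebra.invol_apply] at hv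
      have hι : (1 + X : IwasawaAlgebra p) * (IwasawaAlgebra.invSubOne p + 1) = 1 := by
        rw [add_comm (IwasawaAlgebra.invSubOne p) 1]
        exact IwasawaAlgebra.one_add_X_mul_one_add_invSubOne p
      have h1 : ¬ (p : ℤ_[p]) ∣ coeff 1 ξ := by rw [← hl]; exact not_dvd_coeff_lam hξ0 hμξ
      exact hc0ne (constantCoeff_eq_zero_of_subst_eq_mul hp hι hc0dvd h1 hv)
  have hspan : Ideal.span ({ξ} : Set (IwasawaAlgebra p)) = Ideal.span {L} :=
    span_eq_span_of_dvd_of_lam_le hL0 ⟨h, hh⟩ hμ (by rw [hlam]; exact hlamξ)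
  exact exists_generator_of_span_eq W p h5 h3 hp hgood hap hf hϖ hξ' hspan

/-! ## §3. Both branches, and the X7 small-image reading -/

/-- **On the `λ = 2` stratum at ANY image, granted `μ^ε = 0`: MC(ε) holds UNLESS `Sel_{p^∞}(E/ℚ)` is finite with
`p ∤ Tam·#Sel`** — granted `hAFE` (used on the finite branch only), `h12 h41 h5 h3 hK13 hpar` BY NAME. The small-image
twin of `LargeImageLambdaTwoStratum.kobayashiMainConjecture_of_lam_eq_two_of_imp_of_afe` (no `Surj`, no `hL20`).
[cite: Kobayashi2003, Thm. 1.2, Thm. 4.1 and Conjecture (p. 2)] [cite: KimBD2008MRL, Thm. 3.12 (p. 93)]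
[cite: BDKim2013, Cor. 3.15 (p. 199)] [cite: DokchitserDokchitserAnnals2010, Thm. 1.4] -/
theorem kobayashiMainConjecture_of_lam_eq_two_of_imp_of_afe_of_mu
    (h12 : Kobayashi2003.thm12_signedSelmerDual_finite_torsion)
    (h41 : Kobayashi2003.thm41_signedCharIdeal_divisibility)
    (h5 : realPeriodRat_eq_unit_mul_plusPeriod) (h3 : realPeriodRat_eq_unit_mul_plusPeriod_three)
    (hK13 : BDKim2013.cor315_signedCharValue_rankZero) (hpar : p_parity W p)
    (hp : p ≠ 2) (hgood : W.HasGoodReductionAtPrime p) (hap : W.frobeniusTrace p = 0) (ε : ℤˣ)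
    (hAFE : ∀ (κ : ZpExtension ℚ p) (γ : Field.absoluteGaloisGroup ℚ), κ.IsCyclotomic →
      κ.IsTopGenerator γ → ∀ D : SignedSelmerDualData W κ γ ε,
        Ideal.map (IwasawaAlgebra.invol p) D.charIdeal = D.charIdeal)
    [NeZero (W.conductorNorm ℤ)] {f₀ : CuspForm (Gamma0 (W.conductorNorm ℤ)) 2} (hf₀ : IsNewformOf W f₀)
    (hcert₀ : ∀ L : IwasawaAlgebra p, IsSignedPAdicLFunction f₀ p ε L → mu L = 0 ∧ lam L = 2)
    (hμX : ∀ (κ : ZpExtension ℚ p) (γ : Field.absoluteGaloisGroup ℚ), κ.IsCyclotomic → κ.IsTopGenerator γ →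
      IsCyclotomicVariable p γ → ∀ (D : SignedSelmerDualData W κ γ ε) (ξ : IwasawaAlgebra p),
        D.charIdeal = Ideal.span {ξ} → mu ξ = 0)
    (hres : Finite (W.selmerGroupPInfty p) → p ∣ W.tamagawaProduct * Nat.card (W.selmerGroupPInfty p)) :
    KobayashiMainConjecture W p ε := by
  by_cases h0 : W.selmerCorank p = 0
  · have hfin : Finite (W.selmerGroupPInfty p) := by
      have hprim : ∀ x : W.selmerGroupPInfty p, ∃ k : ℕ, p ^ k • x = 0 := fun x ↦ by
        obtain ⟨k, hk⟩ := exists_pow_nsmul_eq_zero_galH1Primary W p (x : galH1Primary W p)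
        exact ⟨k, Subtype.ext (by rw [AddSubmonoidClass.coe_nsmul, hk, ZeroMemClass.coe_zero])⟩
      haveI : Finite (AddSubgroup.torsionBy (W.selmerGroupPInfty p) (p : ℤ)) :=
        W.finite_torsionBy_selmerGroupPInfty
      exact finite_of_zpCorank_eq_zero p hprim h0
    exact kobayashiMainConjecture_of_lam_eq_two_of_finite_of_dvd_of_afe_of_mu W p h12 h41 h5 h3 hK13 hp hgood hap ε
      hAFE hf₀ hcert₀ hμX hfin (hres hfin)
  · exact kobayashiMainConjecture_of_lam_eq_two_of_selmerCorank_ne_zero_of_mu W p h12 h41 h5 h3 hpar hp hgood hap ε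
      hf₀ hcert₀ hμX h0

/-- **Crux 4's conclusion at an X7 SMALL-IMAGE pair on the `λ = 2` stratum**, `¬ W.HasCM` and `¬ Surj W p` displayed and
unused: `∃ ε, KobayashiMainConjecture W p ε` granted the certificate `(0, 2)` for `ε`, `μ^ε = 0`, `hAFE`, the `hres` bit
and the prints. CALIBRATION ONLY. [cite: Kobayashi2003, Thm. 1.2, Thm. 4.1 and Conjecture (p. 2)]
[cite: KimBD2008MRL, Thm. 3.12 (p. 93)] [cite: BDKim2013, Cor. 3.15 (p. 199)] [cite: DokchitserDokchitserAnnals2010, Thm. 1.4] -/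
theorem X7.exists_kobayashiMainConjecture_of_lam_eq_two_of_imp_of_afe_of_mu
    (h12 : Kobayashi2003.thm12_signedSelmerDual_finite_torsion)
    (h41 : Kobayashi2003.thm41_signedCharIdeal_divisibility)
    (h5 : realPeriodRat_eq_unit_mul_plusPeriod) (h3 : realPeriodRat_eq_unit_mul_plusPeriod_three)
    (hK13 : BDKim2013.cor315_signedCharValue_rankZero) (hpar : p_parity W p)
    (hp : p ≠ 2) (hX : ClassX7 W p) (_hCM : ¬ W.HasCM) (hap : W.frobeniusTrace p = 0) (_hs : ¬ Surj W p) {ε : ℤˣ}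
    (hAFE : ∀ (κ : ZpExtension ℚ p) (γ : Field.absoluteGaloisGroup ℚ), κ.IsCyclotomic →
      κ.IsTopGenerator γ → ∀ D : SignedSelmerDualData W κ γ ε,
        Ideal.map (IwasawaAlgebra.invol p) D.charIdeal = D.charIdeal)
    [NeZero (W.conductorNorm ℤ)] {f₀ : CuspForm (Gamma0 (W.conductorNorm ℤ)) 2} (hf₀ : IsNewformOf W f₀)
    (hcert₀ : ∀ L : IwasawaAlgebra p, IsSignedPAdicLFunction f₀ p ε L → mu L = 0 ∧ lam L = 2)
    (hμX : ∀ (κ : ZpExtension ℚ p) (γ : Field.absoluteGaloisGroup ℚ), κ.IsCyclotomic → κ.IsTopGenerator γ →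
      IsCyclotomicVariable p γ → ∀ (D : SignedSelmerDualData W κ γ ε) (ξ : IwasawaAlgebra p),
        D.charIdeal = Ideal.span {ξ} → mu ξ = 0)
    (hres : Finite (W.selmerGroupPInfty p) → p ∣ W.tamagawaProduct * Nat.card (W.selmerGroupPInfty p)) :
    ∃ ε : ℤˣ, KobayashiMainConjecture W p ε :=
  ⟨ε, kobayashiMainConjecture_of_lam_eq_two_of_imp_of_afe_of_mu W p h12 h41 h5 h3 hK13 hpar hp hX.1.1 hap ε hAFE hf₀
    hcert₀ hμX hres⟩

end Summit.BirchSwinnertonDyer.BirchSwinnertonDyer.Theorems.SmallImageLambdaTwoStratum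

end
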